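import Summits.BirchSwinnertonDyer.BirchSwinnertonDyer.Theorems.KimAtThreeKolyvaginIsogenyCruxes
import Summits.BirchSwinnertonDyer.BirchSwinnertonDyer.Theorems.KimAtThreeShallowEqDeepCertificateBound
import HarnessLib

/-!
# Route `KimAtThreeKolyvagin` (rung W2), crux `ShallowEqDeepAtTorsionFree` (item 19077): the crux FROM
# the threshold-one END-shape bound + crux 19076's conclusion, on OPTIMAL parametrised curves only

Cell `bsd-addord`, seat `bsd-addord-kim3` (gen 9). TOOL FILE: one theorem (no definition, no named fact, no
`sorry`); closes nothing (the hypothesis is crux-sized), books nothing. The 19077 member of the trio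
`KimAtThreeKolyvaginIsogenyEndShape` (19075) / `…IsogenyEndRow` (19076): it composes
* w2-c4's `shallowEqDeep_datum_of_deepUpper_of_endShapeBound` (p419289: for a tower row with datum `D`,
  unit period transfer and `ord(δ̃) = 0`, the END-shape bound at threshold `K = 1` — i.e. n1011's END road
  at `t = 0` — together with crux 19076's conclusion at the row gives crux 19077's conclusion for `D.f`;
  «19077 is not an independent obligation on the END road», w2-c4's reading of record), with
* kim3 g9's `shallowEqDeepAtTorsionFree_of_forall_optimalDatum` (p425479),
so that both inputs need only be produced on globally minimal `W₀` with a lattice-OPTIMAL, degree-MINIMAL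
datum `D₀` and `E(ℚ₃)[3] = 0`: `shallowEqDeepAtTorsionFree_of_endShapeBoundOne_of_deepUpper_optimal`.

References: [Kim2025RefinedTNC] Thm 1.1; [Kim2022StructureSelmer] Thm. 1.9 (6); [MazurRubin2004] Thm.
5.2.12; [EdixhovenManin1991] Prop. 2; memo `run/shared/lean/pub/bsd-addord/kim3/KIM3-W2-ISOGENY-g9.md`,
`KIM3-PROOF.md` §17 (Lemma K), `w2c4/W2C4-SHALLOWEQDEEP-g0.md`.
-/

-- the Theorems namespace of a single-conjunct summit repeats the summit name by design (D-0017)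
set_option linter.dupNamespace false

noncomputable section

open scoped Classical
open Function WeierstrassCurve CongruenceSubgroup
  Literature.NumberTheory.EllipticCurves Literature.NumberTheory.EllipticCurves.ModularForms
  Summit.BirchSwinnertonDyer.BirchSwinnertonDyer.Theses.KimAtThreeKolyvagin
  Summit.BirchSwinnertonDyer.BirchSwinnertonDyer.Theorems.KimAtThreeKolyvaginIsogenyCruxes
  Summit.BirchSwinnertonDyer.BirchSwinnertonDyer.Theorems.KimAtThreeShallowEqDeepCertificateBound

namespace Summit.BirchSwinnertonDyer.BirchSwinnertonDyer.Theorems.KimAtThreeKolyvaginIsogenyEndShapeShallow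

/-- **Crux `ShallowEqDeepAtTorsionFree` ⟸ (threshold-one END-shape bound ∧ crux 19076's conclusion) on
every OPTIMAL parametrised tower row with `E(ℚ₃)[3] = 0`.** If for every globally minimal `W₀` with the
`3`-adic tower onto, `#E(ℚ₃)[3] = 1`, `Ш` finite, and every lattice-optimal, degree-minimal datum `D₀`
(any level) with `3`-integral plus symbols and `ord(δ̃) = 0`, one has the unit period transfer, the
END-shape bound with threshold `K = 1` (every minimal certificate `δ̃_n ≢ 0 (mod 3^{j′})` at a cyclic
`n ∈ 𝒩_L`, `1 + j′ ≤ L + 1`, gives `ord₃(L(E,1)/Ω) ≤ ord₃ #Ш(3) + (j′ − 1)`) and crux 19076's conclusion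
at `(W₀, D₀.f)`, then `ShallowEqDeepAtTorsionFree` holds (every tower row, every newform — isogeny
transport). [cite: Kim2025RefinedTNC, Thm 1.1] [cite: Kim2022StructureSelmer, Thm. 1.9 (6)]
[cite: EdixhovenManin1991, Prop. 2] -/
theorem shallowEqDeepAtTorsionFree_of_endShapeBoundOne_of_deepUpper_optimal
    (h : ∀ (W₀ : WeierstrassCurve ℚ) [W₀.IsElliptic] [W₀.IsGloballyMinimal],
      (∀ n : ℕ, W₀.HasSurjectiveModNGaloisRep (3 ^ n : ℕ)) →
      Nat.card {Q : (W₀.baseChange ℚ_[3]).toAffine.Point // (3 : ℕ) • Q = 0} = 1 → Finite W₀.sha →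
      ∀ {N : ℕ} [NeZero N] (D₀ : ModularParametrizationData W₀ N),
        (∀ z ∈ D₀.L.lattice, ∃ w ∈ periodLattice D₀.f, z = D₀.c * w) →
        (∀ (W₂ : WeierstrassCurve ℚ) [W₂.IsElliptic] (D₂ : ModularParametrizationData W₂ N),
          D₂.f = D₀.f → D₀.modularDegree ≤ D₂.modularDegree) →
        (∀ r : ℚ, ratPlusSymbol D₀.f r ≠ 0 → 0 ≤ padicValRat 3 (ratPlusSymbol D₀.f r)) →
        kuriharaVanishingOrder W₀ 3 D₀.f = 0 →
        (∃ u : ℚ, ‖(u : ℚ_[3])‖ = 1 ∧ W₀.realPeriodRat = u * plusPeriod D₀.f) ∧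
        (∀ (j' L n : ℕ), 1 ≤ j' → 1 + j' ≤ L + 1 → IsCyclicKolyvaginLevel W₀ 3 n →
          ∀ hL : Kato.IsKolyvaginProduct W₀ 3 L n,
          ∀ ψ : (ℓ : ℕ) → (ZMod ℓ)ˣ →* Multiplicative (ZMod (3 ^ j')),
            (∀ ℓ ∈ n.primeFactors, Function.Surjective (ψ ℓ)) →
            (haveI : NeZero n := ⟨hL.ne_zero⟩; kuriharaNumber D₀.f (3 ^ j') n ψ ≠ 0) →
            (∀ d : ℕ, d ∣ n → 1 < d → d < n → ∀ [NeZero d], kuriharaNumber D₀.f (3 ^ j') d ψ = 0) →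
            ∃ q : ℚ, W₀.entireLFunction 1 / (W₀.realPeriodRat : ℂ) = (q : ℂ) ∧
              padicValRat 3 q ≤
                (padicValNat 3 (Nat.card (AddCommGroup.primaryComponent W₀.sha 3)) : ℤ) +
                  ((j' - 1 : ℕ) : ℤ)) ∧
        ∃ d : ℕ, kuriharaPartialDeepInfty W₀ 3 D₀.f = d ∧
          ((padicValNat 3 (Nat.card (AddCommGroup.primaryComponent W₀.sha 3)) + d : ℕ) : ℕ∞) ≤
            kuriharaPartial W₀ 3 D₀.f 0) :
    ShallowEqDeepAtTorsionFree := by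
  refine shallowEqDeepAtTorsionFree_of_forall_optimalDatum
    fun W₀ _ _ htow _ hfin N _ D₀ hopt hdeg hint hord => ?_
  obtain ⟨hper, hEnd, hU⟩ := h W₀ htow ‹_› hfin D₀ hopt hdeg hint hord
  exact shallowEqDeep_datum_of_deepUpper_of_endShapeBound W₀ htow D₀ hper hord hEnd hU

end Summit.BirchSwinnertonDyer.BirchSwinnertonDyer.Theorems.KimAtThreeKolyvaginIsogenyEndShapeShallow

end
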